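/-
Copyright: the b2b-balaban cell (near-miss cell 7), T⁴-continuum fan-out; row NE7b ROUND-2 swarm, seat
t4-ne7b-formalise-leaf-10 (gen 12; row S12o «CONCAVE ENTROPY REPAIR» part (i-c), file 2∕2, of
`t4/b2b-balaban-t4-ne7b-p1/LEAVES-NE7b.md`, owner's division R-OWNER-23-15 ∕ journal l.17953; finding F-leaf10g12-1).
Released under the licence of the surrounding project.
-/
import Summits.QuantumFields.BalabanUV.T4Continuum.Support.HistoryJoinsPlacedOmega

/-!
# Placed root data with a scale `Ω`, file 2∕2: the EXACT non-host count, the sharp product bound, and the corollary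
# in the letters of the wiring (row S12o part (i-c))

Summits-side support leaf of the T⁴-continuum cell (rung (B)+1 on a FINITE torus only; NOT infinite volume, NOT the
mass gap, NOT the Clay statement; NOT a proof of the spine estimate NE7b).  Row NE7b, route «COUNT», row S12o
«CONCAVE ENTROPY REPAIR», part (i-c), sequel of `HistoryJoinsPlacedOmega` (p228504).  [folklore] tree bookkeeping and
real arithmetic over the swarm's OWN carrier; nothing is quoted from print, nothing printed is asserted, no `[cite:]`
tag, no `Prop` fact, no definition, no constant of print; touches no existing file.

WHY.  `HistoryJoinsNonhost.MρP_le_exp_of_nonhost_law` (used by file 1's `MρP_placedΩ_le_exp`) charges the per-part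
constant `a + d·c₀` of the radius factor against ALL parts (`≤ 2·nmerges G`); the NON-HOST parts number EXACTLY
`nmerges G` (`Σ_J (npart J − 1)`, by `HistoryZoneMassJoins.sum_length_tparts_eq`).  After the concave repair that
constant carries the logarithm `d·log(2ρ₀+1)` of the whole distance budget, so the factor `2` is worth removing.
The last theorem restates file 1's product bound in the letters part (ii)'s wiring produces.

WHAT.
* §1 `npart_merge_pos`, **`nhsum_const_merge`** (`nhsum (fun _ ⇒ c) (merge …) = c·(npart − 1)`), `npart_eq_length_tparts`,
  **`sum_joins_nhsum_const_eq`** (`Σ_{X ∈ joins} nhsum (fun _ ⇒ c) X = c·nmerges G`).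
* §2 **`MρP_le_exp_of_nonhost_law_sharp`**: `MρP ≤ exp((a + d·c₀)·nmerges G + d·C₀·Φ)` (the tree's statement with
  `2·nmerges ↦ nmerges`); **`MρP_placedΩ_le_exp_sharp`**: file 1's §3 with `2(a′ + d′c₉) ↦ (a′ + d′c₉)`.
* §3 **`MρP_placedΩ_le_exp_split`** — THE WIRING-SHAPED COROLLARY: potential total `(K₁ + Ω·K₂)·F` (`K₁` the distance
  part, e.g. `ρℓ·(WB+WM)∕(1−θ)`; `K₂` the root-template part scaled by `Ω`, e.g. `Cr = 4·2^d`), `C₀ ≤ 1`, scale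
  `Ω := K₁ + c₉ + 1`, pivot `ρ₀ := Ω·(1 + K₂)`:
  `MρP ≤ exp((a₁ + 3d₁ + 2d + d₁·K₂ + d·log(2Ω(1 + K₂) + 1))·F)` — the template entropy `d₁·K₂` survives (genuine,
  [B16] p. 384's «exp O(1)(MR_j)^{−d}|Z_j|» kind), the distance enters through ONE logarithm (census: ≈ 5.6·10² at
  d = 4, L = 13, collar 32, against the tree's 2.35·10²⁷).

HONEST SCOPE.  As file 1: not yet wired; END of record, `Θ`, socket, exits, `HistoryConstants*`, displays, headline
Prop untouched.  NE7b NOT proved; spine 0∕9.  HONEST DEPENDENCY (cell): continuum YM on T⁴ ⇐ BetaPertH ∧ nine spine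
estimates (0/9 proved); BetaPertH ⇐ (D1) ∧ (D4) ∧ CAP+tail; G-an2-4 gates asym, D1 and NE2/3/4.  Unchanged here.
-/

open Finset
open Literature.MathematicalPhysics.QuantumFieldTheory.Balaban1983to89
open T4PersistenceDictionary T4PartnerMultiplicity T4BranchingRecordsGas
open Summit.QuantumFields.BalabanUV.T4Continuum.HistoryJoins
open Summit.QuantumFields.BalabanUV.T4Continuum.HistoryJoinsAdm
open Summit.QuantumFields.BalabanUV.T4Continuum.HistoryJoinsBudget
open Summit.QuantumFields.BalabanUV.T4Continuum.HistoryJoinsSup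
open Summit.QuantumFields.BalabanUV.T4Continuum.HistoryJoinsSupTorus
open Summit.QuantumFields.BalabanUV.T4Continuum.HistoryJoinsRadius
open Summit.QuantumFields.BalabanUV.T4Continuum.HistoryJoinsNonhost
open Summit.QuantumFields.BalabanUV.T4Continuum.HistoryJoinsPlaced
open Summit.QuantumFields.BalabanUV.T4Continuum.HistoryJoinsBudgetPivot
open Summit.QuantumFields.BalabanUV.T4Continuum.HistoryJoinsPlacedOmega
open Summit.QuantumFields.BalabanUV.T4Continuum.ZoneTorus
open Summit.QuantumFields.BalabanUV.T4Continuum.ZoneSkeleton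
open Summit.QuantumFields.BalabanUV.T4Continuum.HistoryZones
open Summit.QuantumFields.BalabanUV.T4Continuum.HistoryMassPlacement
open Summit.QuantumFields.BalabanUV.T4Continuum.HistoryZoneMassJoins

namespace Summit.QuantumFields.BalabanUV.T4Continuum.HistoryJoinsPlacedOmegaSharp

noncomputable section

open scoped Classical

/-! ## §1–§3 The EXACT non-host count, the sharp product bound, and the wiring-shaped corollary

The tree's `HistoryJoinsNonhost.MρP_le_exp_of_nonhost_law` charges the per-part constant against `2·nmerges G` (all
parts); the non-host parts number EXACTLY `nmerges G` (`Σ_J (npart J − 1)`, `HistoryZoneMassJoins.sum_length_tparts_eq`),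
which halves the logarithmic term of §3.  `MρP_placedΩ_le_exp_split` is the corollary in the letters of part (ii)'s
wiring: potential total `(K₁ + Ω·K₂)·F` (`K₁` = the distance part, `K₂` = the root-template part scaled by `Ω`), scale
`Ω := K₁ + c₉ + 1`, pivot `ρ₀ := Ω·(1 + K₂)`. -/

section Sharp

variable {ε : Type*} (st : ε → ℕ)

/-- a top join has at least one part (its host) [folklore] -/
theorem npart_merge_pos (X Y : Gen ε) (e : ε) : 0 < npart st (Gen.merge X Y e) := (hostIdx st X Y e).pos

/-- **THE NON-HOST SUM OF A CONSTANT AT A MERGER**: `c·(npart − 1)`. [folklore] -/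
theorem nhsum_const_merge (c : ℝ) (X Y : Gen ε) (e : ε) :
    nhsum st (fun _ => c) (Gen.merge X Y e) = c * ((npart st (Gen.merge X Y e) : ℝ) - 1) := by
  have hpos := npart_merge_pos st X Y e
  rw [nhsum_merge, sum_const, nsmul_eq_mul, Finset.filter_ne', card_erase_of_mem (mem_univ _), card_univ,
    Fintype.card_fin, Nat.cast_sub hpos, Nat.cast_one, mul_comm]

/-- the part count of a top join is the length of its part list [folklore] -/
theorem npart_eq_length_tparts (X Y : Gen ε) (e : ε) :
    npart st (Gen.merge X Y e) = (tparts st (Gen.merge X Y e)).length := by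
  simp [npart, tparts]

/-- **THE NON-HOST PARTS OF ALL JOINS NUMBER EXACTLY `nmerges G`**: `Σ_{X ∈ joins} nhsum (fun _ ⇒ c) X = c·nmerges G`.
[folklore] -/
theorem sum_joins_nhsum_const_eq (c : ℝ) (G : Gen ε) :
    ((joins st G).map fun X => nhsum st (fun _ => c) X).sum = c * (nmerges G : ℝ) := by
  have hlen := sum_length_tparts_eq st G
  -- every join is a merger, where the non-host sum of a constant is `c·(length − 1)`
  have key : ∀ l : List (Gen ε), (∀ X ∈ l, ∃ A B e, X = Gen.merge A B e) →
      (l.map fun X => nhsum st (fun _ => c) X).sum =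
        c * (((l.map fun X => (tparts st X).length).sum : ℕ) : ℝ) - c * (l.length : ℝ) := by
    intro l hl
    induction l with
    | nil => simp
    | cons X l ih =>
        have hX := hl X (List.mem_cons_self)
        have hl' : ∀ Y ∈ l, ∃ A B e, Y = Gen.merge A B e := fun Y hY => hl Y (List.mem_cons_of_mem _ hY)
        obtain ⟨A, B, e, rfl⟩ := hX
        simp only [List.map_cons, List.sum_cons, List.length_cons, Nat.cast_add, Nat.cast_one]
        rw [ih hl', nhsum_const_merge, npart_eq_length_tparts]
        ring
  have hall : ∀ X ∈ joins st G, ∃ A B e, X = Gen.merge A B e := fun X hX => exists_eq_merge_of_mem_joins st hX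
  rw [key _ hall, hlen]
  push_cast
  ring

variable (ext : ℕ → Gen ε → ℝ) (Mρ : ℝ → ℝ)

/-- **`MρP` UNDER THE EXTENT LAW AT THE NON-HOST PARTS, SHARP COUNT**: as
`HistoryJoinsNonhost.MρP_le_exp_of_nonhost_law` with the constant charged against `nmerges G` (not `2·nmerges G`):
`MρP ≤ exp((a + d·c₀)·nmerges G + d·C₀·Φ)`. [folklore] -/
theorem MρP_le_exp_of_nonhost_law_sharp {a d : ℝ} (hd : 0 ≤ d) (hMρ0 : ∀ r, 0 ≤ Mρ r)
    (hMρ : ∀ r, 0 ≤ r → Mρ r ≤ Real.exp (a + d * r)) (hext0 : ∀ t P, 0 ≤ ext t P)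
    {C₀ c₀ : ℝ} (hC₀ : 0 ≤ C₀) (φ : ℕ → Gen ε → ℝ) (G : Gen ε)
    (hlaw : ∀ (X Y : Gen ε) (e : ε), Gen.merge X Y e ∈ joins st G → ∀ i, i ≠ hostIdx st X Y e →
      ext (st e) (part st (Gen.merge X Y e) i).2 ≤ C₀ * φ (st e) (part st (Gen.merge X Y e) i).2 + c₀)
    {Φ : ℝ} (hΦ : ((joins st G).map fun X => nhsum st (φ (ftime st X)) X).sum ≤ Φ) :
    MρP st ext Mρ G ≤ Real.exp ((a + d * c₀) * nmerges G + d * C₀ * Φ) := by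
  refine (MρP_le_exp_sum_nhsum st ext Mρ hMρ0 hMρ hext0 G).trans (Real.exp_le_exp.2 ?_)
  -- pointwise at the non-host parts of each join
  have h1 : ((joins st G).map fun X => nhsum st (fun P => a + d * ext (ftime st X) P) X).sum ≤
      ((joins st G).map fun X => nhsum st (fun P => a + d * (C₀ * φ (ftime st X) P + c₀)) X).sum := by
    refine List.sum_le_sum fun X hX => ?_
    obtain ⟨A, B, e, rfl⟩ : ∃ A B e, X = Gen.merge A B e := exists_eq_merge_of_mem_joins st hX
    rw [nhsum_merge, nhsum_merge]
    refine sum_le_sum fun i hi => ?_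
    have := hlaw A B e hX i (mem_filter.1 hi).2
    have hft : ftime st (Gen.merge A B e) = st e := rfl
    rw [hft]
    nlinarith
  refine h1.trans ?_
  -- split the affine form: constants against the EXACT non-host count, the potential against `Φ`
  have h2 : ((joins st G).map fun X => nhsum st (fun P => a + d * (C₀ * φ (ftime st X) P + c₀)) X).sum =
      ((joins st G).map fun X => nhsum st (fun _ => a + d * c₀) X).sum +
        d * C₀ * ((joins st G).map fun X => nhsum st (φ (ftime st X)) X).sum := by
    induction joins st G with
    | nil => simp
    | cons X l ihl =>
        simp only [List.map_cons, List.sum_cons]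
        rw [ihl]
        have hX : nhsum st (fun P => a + d * (C₀ * φ (ftime st X) P + c₀)) X =
            nhsum st (fun _ => a + d * c₀) X + d * C₀ * nhsum st (φ (ftime st X)) X := by
          cases X with
          | born b j => simp [nhsum]
          | renew G' e k => simp [nhsum]
          | merge A B e =>
              simp only [nhsum_merge, mul_sum, ← sum_add_distrib]
              exact sum_congr rfl fun i _ => by ring
        rw [hX]; ring
  rw [h2, sum_joins_nhsum_const_eq]
  nlinarith [mul_nonneg hd hC₀]

end Sharp

section PlacedSharp

variable {ε R Tm : Type*} [DecidableEq ε] [LinearOrder R] [Fintype Tm] {d n L K D : ℕ} (sh : ε → PEv)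
  (lv : ℕ → ℕ) (tsz : Tm → ℕ) (Ω : ℝ)
  (zone : ℕ → Gen ε → (Addr D → TCell d (n * L ^ K) × Tm) → Finset (Fin d → ℕ))
  (ρ : (Addr D → TCell d (n * L ^ K) × Tm) → R) (c₀ : TCell d (n * L ^ K) × Tm)

omit [DecidableEq ε] in
/-- **§3 WITH THE SHARP COUNT**: `MρP ≤ exp(((a′ + d′c₉) + d′·C₀·κφ)·F)`, `a′ = a₁ + d₁ + d·log(2ρ₀+1)`,
`d′ = 2d∕(2ρ₀+1) + d₁∕Ω` (half the constant part of `MρP_placedΩ_le_exp`). [folklore] -/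
theorem MρP_placedΩ_le_exp_sharp {A : ℕ → ℕ} {a₁ d₁ : ℝ} (ha : 0 ≤ a₁) (hd : 0 ≤ d₁)
    (hAexp : ∀ m : ℕ, (A m : ℝ) ≤ Real.exp (a₁ + d₁ * m)) (hΩ : 0 < Ω) {ρ₀ : ℝ} (hρ : 0 ≤ ρ₀)
    {C₀ c₉ : ℝ} (hC₀ : 0 ≤ C₀) (hc₉ : 0 ≤ c₉) (φ : ℕ → Gen ε → ℝ) (hφ0 : ∀ t P, 0 ≤ φ t P) (G : Gen ε)
    (hlawR : ∀ (X Y : Gen ε) (e : ε), Gen.merge X Y e ∈ joins (PEv.step ∘ sh) G →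
      ∀ i, i ≠ hostIdx (PEv.step ∘ sh) X Y e →
        ∀ p ∈ Sany zone ρ c₀ (PEv.step ∘ sh) (part (PEv.step ∘ sh) (Gen.merge X Y e) i).2,
          ∀ u ∈ zone (sh e).step (part (PEv.step ∘ sh) (Gen.merge X Y e) i).2 p,
            radPΩ n L K lv tsz Ω u (sh e).step (evalA c₀ p (rootAddr (part (PEv.step ∘ sh) (Gen.merge X Y e) i).2))
                (part (PEv.step ∘ sh) (Gen.merge X Y e) i).2.rootStep ≤
              C₀ * φ (sh e).step (part (PEv.step ∘ sh) (Gen.merge X Y e) i).2 + c₉)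
    {κφ : ℝ}
    (hΦ : ((joins (PEv.step ∘ sh) G).map fun X => nhsum (PEv.step ∘ sh) (φ (ftime (PEv.step ∘ sh) X)) X).sum ≤
      κφ * bsum (fun b => (((sh b).fat : ℕ) : ℝ) + 1) G) :
    MρP (PEv.step ∘ sh) (extsup zone ρ c₀ (PEv.step ∘ sh) (radPΩ n L K lv tsz Ω)) (MρPΩ' d Ω A) G ≤
      Real.exp ((((a₁ + d₁ + (d : ℝ) * Real.log (2 * ρ₀ + 1)) +
            (2 * (d : ℝ) / (2 * ρ₀ + 1) + d₁ / Ω) * c₉) +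
          (2 * (d : ℝ) / (2 * ρ₀ + 1) + d₁ / Ω) * C₀ * κφ) *
        bsum (fun b => (((sh b).fat : ℕ) : ℝ) + 1) G) := by
  set st := PEv.step ∘ sh
  set F := bsum (fun b => (((sh b).fat : ℕ) : ℝ) + 1) G
  set a' : ℝ := a₁ + d₁ + (d : ℝ) * Real.log (2 * ρ₀ + 1) with ha'_def
  set d' : ℝ := 2 * (d : ℝ) / (2 * ρ₀ + 1) + d₁ / Ω with hd'_def
  have hlog : 0 ≤ Real.log (2 * ρ₀ + 1) := Real.log_nonneg (by linarith)
  have ha' : 0 ≤ a' := by rw [ha'_def]; positivity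
  have h2ρ : (0 : ℝ) < 2 * ρ₀ + 1 := by linarith
  have hd' : 0 ≤ d' := by rw [hd'_def]; positivity
  have h := MρP_le_exp_of_nonhost_law_sharp st (extsup zone ρ c₀ st (radPΩ n L K lv tsz Ω)) (MρPΩ' d Ω A) hd'
    (fun r => MρPΩ'_nonneg A r) (fun r hr => MρPΩ'_le_exp_pivot (d := d) hd hAexp hΩ hρ hr)
    (fun t P => extsup_nonneg zone ρ c₀ st _ t P) hC₀ φ G
    (fun X Y e hX i hi => extsup_le_of_forall zone ρ c₀ st (radPΩ n L K lv tsz Ω)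
      (add_nonneg (mul_nonneg hC₀ (hφ0 _ _)) hc₉) (hlawR X Y e hX i hi)) le_rfl
  refine h.trans (Real.exp_le_exp.2 ?_)
  have hn : (nmerges G : ℝ) + 1 ≤ F := nmerges_lt_bsum sh G
  have hn0 : (0 : ℝ) ≤ nmerges G := Nat.cast_nonneg _
  have hac : 0 ≤ a' + d' * c₉ := by positivity
  have hdC : 0 ≤ d' * C₀ := by positivity
  have h1 : (a' + d' * c₉) * (nmerges G : ℝ) ≤ (a' + d' * c₉) * F := by nlinarith
  have h2 : d' * C₀ * ((joins st G).map fun X => nhsum st (φ (ftime st X)) X).sum ≤ d' * C₀ * κφ * F := by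
    have := mul_le_mul_of_nonneg_left hΦ hdC
    linarith [this]
  linarith

omit [DecidableEq ε] in
/-- **THE WIRING-SHAPED COROLLARY** (for part (ii)): with the potential's total split as `(K₁ + Ω·K₂)·F` — `K₁` the
distance part (e.g. `ρℓ·(WB+WM)∕(1−θ)`), `K₂` the root-template part scaled by `Ω` (e.g. `Cr = 4·2^d`) — the scale
`Ω := K₁ + c₉ + 1` and the pivot `ρ₀ := Ω·(1 + K₂)` give
`MρP ≤ exp((a₁ + 3d₁ + 2d + d₁·K₂ + d·log(2Ω(1 + K₂) + 1))·F)`: the template entropy `d₁·K₂` survives (it is genuine),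
the distance enters through ONE logarithm. [folklore] -/
theorem MρP_placedΩ_le_exp_split {A : ℕ → ℕ} {a₁ d₁ : ℝ} (ha : 0 ≤ a₁) (hd : 0 ≤ d₁)
    (hAexp : ∀ m : ℕ, (A m : ℝ) ≤ Real.exp (a₁ + d₁ * m))
    {C₀ c₉ K₁ K₂ : ℝ} (hC₀ : 0 ≤ C₀) (hc₉ : 0 ≤ c₉) (hK₁ : 0 ≤ K₁) (hK₂ : 0 ≤ K₂) (hC₀1 : C₀ ≤ 1)
    (hΩ : Ω = K₁ + c₉ + 1)
    (φ : ℕ → Gen ε → ℝ) (hφ0 : ∀ t P, 0 ≤ φ t P) (G : Gen ε)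
    (hlawR : ∀ (X Y : Gen ε) (e : ε), Gen.merge X Y e ∈ joins (PEv.step ∘ sh) G →
      ∀ i, i ≠ hostIdx (PEv.step ∘ sh) X Y e →
        ∀ p ∈ Sany zone ρ c₀ (PEv.step ∘ sh) (part (PEv.step ∘ sh) (Gen.merge X Y e) i).2,
          ∀ u ∈ zone (sh e).step (part (PEv.step ∘ sh) (Gen.merge X Y e) i).2 p,
            radPΩ n L K lv tsz Ω u (sh e).step (evalA c₀ p (rootAddr (part (PEv.step ∘ sh) (Gen.merge X Y e) i).2))
                (part (PEv.step ∘ sh) (Gen.merge X Y e) i).2.rootStep ≤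
              C₀ * φ (sh e).step (part (PEv.step ∘ sh) (Gen.merge X Y e) i).2 + c₉)
    (hΦ : ((joins (PEv.step ∘ sh) G).map fun X => nhsum (PEv.step ∘ sh) (φ (ftime (PEv.step ∘ sh) X)) X).sum ≤
      (K₁ + Ω * K₂) * bsum (fun b => (((sh b).fat : ℕ) : ℝ) + 1) G) :
    MρP (PEv.step ∘ sh) (extsup zone ρ c₀ (PEv.step ∘ sh) (radPΩ n L K lv tsz Ω)) (MρPΩ' d Ω A) G ≤
      Real.exp ((a₁ + 3 * d₁ + 2 * (d : ℝ) + d₁ * K₂ + (d : ℝ) * Real.log (2 * (Ω * (1 + K₂)) + 1)) *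
        bsum (fun b => (((sh b).fat : ℕ) : ℝ) + 1) G) := by
  have hΩ1 : 1 ≤ Ω := by rw [hΩ]; linarith
  have hΩ0 : 0 < Ω := lt_of_lt_of_le one_pos hΩ1
  set ρ₀ : ℝ := Ω * (1 + K₂) with hρ₀
  have hρ₀Ω : Ω ≤ ρ₀ := by rw [hρ₀]; nlinarith
  have hρ₀0 : 0 ≤ ρ₀ := le_trans hΩ0.le hρ₀Ω
  have h := MρP_placedΩ_le_exp_sharp sh lv tsz Ω zone ρ c₀ ha hd hAexp hΩ0 hρ₀0 hC₀ hc₉ φ hφ0 G hlawR hΦ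
  refine h.trans (Real.exp_le_exp.2 (mul_le_mul_of_nonneg_right ?_ (bsum_nonneg (fun _ => by positivity) G)))
  have h2ρ : (0 : ℝ) < 2 * ρ₀ + 1 := by linarith
  set d' : ℝ := 2 * (d : ℝ) / (2 * ρ₀ + 1) + d₁ / Ω with hd'
  have hd'0 : 0 ≤ d' := by rw [hd']; positivity
  have hd0 : (0 : ℝ) ≤ d := Nat.cast_nonneg d
  -- `d′·Ω ≤ d + d₁` and `d′·ρ₀ ≤ d + d₁(1 + K₂)`
  have hA1 : 2 * (d : ℝ) / (2 * ρ₀ + 1) * ρ₀ ≤ d := by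
    rw [div_mul_eq_mul_div, div_le_iff₀ h2ρ]; nlinarith
  have hA2 : 2 * (d : ℝ) / (2 * ρ₀ + 1) * Ω ≤ d :=
    le_trans (mul_le_mul_of_nonneg_left hρ₀Ω (by positivity)) hA1
  have hB1 : d₁ / Ω * ρ₀ = d₁ * (1 + K₂) := by
    rw [hρ₀]; field_simp
  have hB2 : d₁ / Ω * Ω = d₁ := by field_simp
  have hdΩ : d' * Ω ≤ d + d₁ := by rw [hd', add_mul, hB2]; linarith
  have hdρ : d' * ρ₀ ≤ d + d₁ * (1 + K₂) := by rw [hd', add_mul, hB1]; linarith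
  -- the potential's total against the pivot: `C₀·(K₁ + ΩK₂) ≤ ρ₀`, `c₉ ≤ Ω`
  have hK : C₀ * (K₁ + Ω * K₂) ≤ ρ₀ := by
    have h1 : C₀ * (K₁ + Ω * K₂) ≤ K₁ + Ω * K₂ := by
      have : 0 ≤ K₁ + Ω * K₂ := by positivity
      nlinarith
    have h2 : K₁ + Ω * K₂ ≤ ρ₀ := by rw [hρ₀, hΩ]; nlinarith
    linarith
  have hc₉Ω : c₉ ≤ Ω := by rw [hΩ]; linarith
  have e1 : d' * c₉ ≤ d + d₁ := le_trans (mul_le_mul_of_nonneg_left hc₉Ω hd'0) hdΩ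
  have e2 : d' * C₀ * (K₁ + Ω * K₂) ≤ d + d₁ * (1 + K₂) := by
    rw [mul_assoc]; exact le_trans (mul_le_mul_of_nonneg_left hK hd'0) hdρ
  have e3 : (d : ℝ) * Real.log (2 * ρ₀ + 1) = (d : ℝ) * Real.log (2 * (Ω * (1 + K₂)) + 1) := by rw [hρ₀]
  nlinarith [e1, e2, e3, hd, hd0, hK₂]

end PlacedSharp

/-! ## §4 Sanity (decided) -/

namespace Sanity

/-- the non-host parts of a two-birth merger number `npart − 1`: the constant non-host sum reads it off -/
example {ε : Type*} (st : ε → ℕ) (X Y : Gen ε) (e : ε) :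
    nhsum st (fun _ => (3 : ℝ)) (Gen.merge X Y e) = 3 * ((npart st (Gen.merge X Y e) : ℝ) - 1) :=
  nhsum_const_merge st 3 X Y e

end Sanity

end

end Summit.QuantumFields.BalabanUV.T4Continuum.HistoryJoinsPlacedOmegaSharp
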